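import Literature.NumberTheory.EllipticCurves.ModifiedTamagawaProduct
import Literature.NumberTheory.EllipticCurves.VariableChangePointsMap
import Literature.Barriers.BirchSwinnertonDyer.RankNotSumOfLocalInvariantsF3
import HarnessLib

/-!
# Class X11b, routes p2/R1: the local index at CONJUGATE places —
# `[E(K_w) : nE(K_w) + im E(K)] = [E(K_{σw}) : nE(K_{σw}) + im E(K)]` for `E/ℚ`, `σ ∈ Aut(K/ℚ)`
# (cell `b2b-bsdres`, sub-cell `multr1-p2`, gen 15)

HONEST FRAMING (verbatim, cell `b2b-bsdres`): the goal of the cell is to DELETE the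
COMBINATION-SHAPED residual classes for ALL analytic-rank `≤ 1` curves over `ℚ` — "full BSD
formula for every rank `≤ 1` curve in class `C`" assembled STRICTLY from published theorems — so
that the rank-`≤ 1` remainder becomes exactly the CONSTRUCTION-SHAPED classes, which are TYPED
(missing-input Props), NOT attempted; this is not "finishing BSD". Research route `p2` for class
X11b; no claim beyond the stated class; nothing booked; X11b stays CONSTRUCTION-SHAPED. Two definitions with bodies
(`galEquivRat`: the Galois transport `σ_w : K_w ≃ K_{σw}` of the tree's `galAdicCompletionEquiv` as a
`ℚ`-algebra isomorphism; `pointTransport`: the induced `E(K_w) ≃+ E(K_{σw})` — plumbing, nothing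
asserted) and theorems; no `sorry`; no named fact.

## What this file proves (namespace `Summit.BirchSwinnertonDyer.Rank1Residual.X11b.LocalIndexSymmetry`)

For `W₀/ℚ`, a number field `K`, `σ : K ≃ₐ[ℚ] K` and places `σ • w = w'` (the tree's Galois action on
`HeightOneSpectrum (𝓞 K)`, `Automorphic/GaloisActionPlaces`):

* `baseChange_baseChange` (`(W₀ ⊗ K) ⊗ E = W₀ ⊗ E`), `galEquivRat`, `pointTransport`;
* **`pointTransport_baseChange`: `σ_w(P_w) = (σP)_{σw}`** — the transport carries the image of
  `P ∈ E(K)` in `E(K_w)` to the image of `σP` (`Affine.Point.map σ`, `W₀` being defined over `ℚ`) in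
  `E(K_{σw})` (coordinates: the tree's `galAdicCompletionMap_coe_algEquiv`);
* **`index_range_baseChange_sup_eq_of_algEquiv_smul`:
  `[E(K_w) : nE(K_w) + im E(K)] = [E(K_{w'}) : nE(K_{w'}) + im E(K)]`** (`σ_w` is an additive
  isomorphism carrying `nE(K_w)` to `nE(K_{w'})` and, `σ` permuting `E(K)`, `im E(K)` to `im E(K)`).

Role for route p2 (input (d) `P2SelmerCardBoundAt`): with `K` imaginary quadratic, `σ` = complex
conjugation and `p = 𝔭𝔭̄` split, the Part-B factor `[E(K_𝔭̄) : p^k E(K_𝔭̄) + im E(K)]`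
(`BDPRouteRelaxation`) equals the Part-A factor at `𝔭` (`BDPRouteStrictAtPlace`), which
`BDPRouteLocalIndex` computes as `p^{min(k, e)}`, `e = ord_p log_ω + ord_p c_p − 1` through THE
embedding at the strict prime `𝔭` — whence the factor `2` in Castella's / JSW's
`2·((ord_p log_ω P − 1) − ord_p[E(K):ℤP])`. Nothing booked; labels unchanged.

References: [CasselsFrohlichANT1967] Ch. VII §1.1 (`σ: K_w ≅ K_{σw}`); [JetchevSkinnerWan2017]
Prop. 3.2.1 and (7.1.5); [Castella2018] (calcul).
-/

noncomputable section

open scoped Classical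

namespace Summit.BirchSwinnertonDyer.Rank1Residual.X11b.LocalIndexSymmetry

open WeierstrassCurve NumberField IsDedekindDomain Literature.NumberTheory.EllipticCurves
  Literature.NumberTheory.Automorphic Literature.Barriers.BirchSwinnertonDyer

variable (W₀ : WeierstrassCurve ℚ) {K : Type} [Field K] [NumberField K] (σ : K ≃ₐ[ℚ] K)
  {w w' : HeightOneSpectrum (𝓞 K)} (h : σ • w = w')

/-- `σ_w : K_w ≃+* K_{σ w}` as a `ℚ`-algebra isomorphism. [folklore] -/
def galEquivRat : w.adicCompletion K ≃ₐ[ℚ] w'.adicCompletion K :=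
  AlgEquiv.ofRingEquiv (f := galAdicCompletionEquiv σ h) fun r => by
    rw [IsScalarTower.algebraMap_apply ℚ K (w.adicCompletion K),
      IsScalarTower.algebraMap_apply ℚ K (w'.adicCompletion K)]
    change galAdicCompletionMap σ h ((algebraMap ℚ K r : K) : w.adicCompletion K) = _
    rw [galAdicCompletionMap_algebraMap]
    rfl

/-- `(W₀ ⊗ K) ⊗ E = W₀ ⊗ E` for a `K`-algebra `E`. [folklore] -/
theorem baseChange_baseChange (E : Type) [Field E] [Algebra K E] [Algebra ℚ E] [IsScalarTower ℚ K E] :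
    (W₀.baseChange K).baseChange E = W₀.baseChange E := by
  change (W₀.baseChange K).map (algebraMap K E) = W₀.baseChange E
  exact W₀.map_baseChange (Algebra.ofId K E)

/-- The transport of local points `E(K_w) ≃+ E(K_{σw})` along `σ_w`. [folklore] -/
def pointTransport : ((W₀.baseChange K).baseChange (w.adicCompletion K)).toAffine.Point ≃+
    ((W₀.baseChange K).baseChange (w'.adicCompletion K)).toAffine.Point :=
  ((Affine.Point.congrEquiv (baseChange_baseChange W₀ (w.adicCompletion K))).trans
    (pointEquivOfAlgEquiv W₀ (galEquivRat σ h))).trans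
    (Affine.Point.congrEquiv (baseChange_baseChange W₀ (w'.adicCompletion K))).symm

/-- `congrEquiv` commutes with `symm` (private copy of the tree's lemma in
`ComplexMultiplicationHasCMProofs`). [folklore] -/
private theorem congrEquiv_symm' {F : Type} [Field F] {V₁ V₂ : WeierstrassCurve F} (e : V₁ = V₂) :
    (Affine.Point.congrEquiv e).symm = Affine.Point.congrEquiv e.symm := by
  subst e; rfl

/-- **`σ_w(P_w) = (σP)_{σw}`**: the transport takes the image of `P ∈ E(K)` in `E(K_w)` to the image of
`σP` in `E(K_{σ w})` (`W₀` is defined over `ℚ`, so `σ` acts on `E(K)`). [folklore] -/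
theorem pointTransport_baseChange (P : (W₀.baseChange K).toAffine.Point) :
    pointTransport W₀ σ h (Affine.Point.baseChange (W' := W₀.baseChange K) K (w.adicCompletion K) P) =
      Affine.Point.baseChange (W' := W₀.baseChange K) K (w'.adicCompletion K)
        (Affine.Point.map (W' := W₀) (σ : K →ₐ[ℚ] K) P) := by
  rcases P with _ | ⟨x, y, hxy⟩
  · exact (map_zero _).trans (by rfl)
  · -- both sides are affine points; compute coordinates
    have hL : ∀ (a b : w.adicCompletion K)
        (hab : ((W₀.baseChange K).baseChange (w.adicCompletion K)).toAffine.Nonsingular a b),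
        ∃ hab', pointTransport W₀ σ h (.some a b hab) =
          .some (galAdicCompletionMap σ h a) (galAdicCompletionMap σ h b) hab' := by
      intro a b hab
      rw [pointTransport, AddEquiv.trans_apply, AddEquiv.trans_apply, Affine.Point.congrEquiv_some,
        congrEquiv_symm']
      exact ⟨_, Affine.Point.congrEquiv_some _ _⟩
    have hns : ((W₀.baseChange K).baseChange (w.adicCompletion K)).toAffine.Nonsingular
        (algebraMap K (w.adicCompletion K) x) (algebraMap K (w.adicCompletion K) y) := by
      exact ((W₀.baseChange K).toAffine.baseChange_nonsingular
        (f := Algebra.ofId K (w.adicCompletion K)) (RingHom.injective _) x y).mpr hxy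
    obtain ⟨hab', hP⟩ := hL (algebraMap K _ x) (algebraMap K _ y) hns
    refine hP.trans ?_
    change Affine.Point.some _ _ _ =
      Affine.Point.some (algebraMap K (w'.adicCompletion K) (σ x)) (algebraMap K (w'.adicCompletion K) (σ y)) _
    congr 1
    · exact galAdicCompletionMap_coe_algEquiv ℚ σ h x
    · exact galAdicCompletionMap_coe_algEquiv ℚ σ h y

/-- **The local index at conjugate places**: for `W₀/ℚ`, `σ ∈ Aut(K/ℚ)` and `σ • w = w'`,
`[E(K_w) : nE(K_w) + im E(K)] = [E(K_{w'}) : nE(K_{w'}) + im E(K)]` (transport along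
`σ_w : K_w ≃ K_{σw}`, which carries `im E(K)` to `im σ(E(K)) = im E(K)`). For an imaginary quadratic
`K`, complex conjugation and `p = 𝔭𝔭̄` split this is the `𝔭 ↔ 𝔭̄` symmetry of the local index of
Castella 2018 (calcul) / JSW 2017 (7.1.5). [cite: CasselsFrohlichANT1967, Ch. VII §1.1]
[cite: JetchevSkinnerWan2017, Prop. 3.2.1 (proof)] -/
theorem index_range_baseChange_sup_eq_of_algEquiv_smul (h : σ • w = w') (n : ℤ) :
    ((Affine.Point.baseChange (W' := W₀.baseChange K) K (w.adicCompletion K)).range ⊔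
        (zsmulAddGroupHom n :
          ((W₀.baseChange K).baseChange (w.adicCompletion K)).toAffine.Point →+ _).range).index =
      ((Affine.Point.baseChange (W' := W₀.baseChange K) K (w'.adicCompletion K)).range ⊔
        (zsmulAddGroupHom n :
          ((W₀.baseChange K).baseChange (w'.adicCompletion K)).toAffine.Point →+ _).range).index := by
  set Φ := pointTransport W₀ σ h with hΦ
  set ιw := Affine.Point.baseChange (W' := W₀.baseChange K) K (w.adicCompletion K) with hιw
  set ιw' := Affine.Point.baseChange (W' := W₀.baseChange K) K (w'.adicCompletion K) with hιw'
  set Nw := (zsmulAddGroupHom n :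
    ((W₀.baseChange K).baseChange (w.adicCompletion K)).toAffine.Point →+ _).range with hNw
  set Nw' := (zsmulAddGroupHom n :
    ((W₀.baseChange K).baseChange (w'.adicCompletion K)).toAffine.Point →+ _).range with hNw'
  -- the image of `E(K)`
  have h1 : ιw.range.map Φ.toAddMonoidHom = ιw'.range := by
    apply le_antisymm
    · rintro _ ⟨_, ⟨P, rfl⟩, rfl⟩
      exact ⟨Affine.Point.map (W' := W₀) (σ : K →ₐ[ℚ] K) P,
        (pointTransport_baseChange W₀ σ h P).symm⟩
    · rintro _ ⟨P, rfl⟩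
      obtain ⟨Q, hQ⟩ := (pointEquivOfAlgEquiv W₀ σ).surjective P
      refine ⟨ιw Q, ⟨Q, rfl⟩, ?_⟩
      change Φ _ = _
      rw [hΦ, hιw, pointTransport_baseChange W₀ σ h Q, ← hQ]
      rfl
  -- the multiples
  have h2 : Nw.map Φ.toAddMonoidHom = Nw' := by
    apply le_antisymm
    · rintro _ ⟨_, ⟨P, rfl⟩, rfl⟩
      exact ⟨Φ P, by rw [zsmulAddGroupHom_apply, zsmulAddGroupHom_apply]; exact (map_zsmul Φ n P).symm⟩
    · rintro _ ⟨P, rfl⟩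
      refine ⟨n • Φ.symm P, ⟨Φ.symm P, rfl⟩, ?_⟩
      change Φ (n • Φ.symm P) = _
      rw [map_zsmul, AddEquiv.apply_symm_apply, zsmulAddGroupHom_apply]
  have h3 : ((ιw.range ⊔ Nw).map Φ.toAddMonoidHom).index = (ιw.range ⊔ Nw).index :=
    AddSubgroup.index_map_of_bijective (f := Φ.toAddMonoidHom) Φ.bijective _
  rw [AddSubgroup.map_sup, h1, h2] at h3
  exact h3.symm

end Summit.BirchSwinnertonDyer.Rank1Residual.X11b.LocalIndexSymmetry

end
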